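import Summits.HodgeConjecture.HodgeConjecture.Theorems.PadicSemiregularLiftHodgeFermatVarietiesPairedOfLargePrimesEven
import Summits.HodgeConjecture.HodgeConjecture.Theorems.PadicSemiregularLiftHodgeFermatVarietiesPairedOfLargePrimesLevel
import Literature.AlgebraicGeometry.HodgeTheory.FermatHodgeCharacters
import HarnessLib

/-!
# Hodge characters of `Xⁿₘ` are paired when every prime factor of `m` exceeds `n + 4`

Crux `HodgeFermatVarieties` (stmt-HodgeConjecture-1334), line `cancel-by-any-claim-lattice`, stub S6 of
the gen-6 skeleton (lead c2): the ARITHMETIC application of the configuration theorems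
`eq_zero_of_null` / `even_of_oddNull` (`…PairedOfLargePrimesNull/Even`) through the level bookkeeping of
`…PairedOfLargePrimesLevel`.

* `isPaired_of_primeFactors_gt` — let `α : Fin R → ℤ/m` be a Hodge character (all entries non-zero,
  `∑ αᵢ = 0`, `2 ∑ ⟨t αᵢ⟩ = m R` for every unit `t`) and assume `R + 2 < p` for every prime `p ∣ m`.
  Then `α` is PAIRED: a fixed-point-free involution `σ` of the indices has `α (σ i) = -α i`.
  For `R = 2r + 2` (characters of the Fermat variety `X²ʳₘ`) the hypothesis reads `p > n + 4`
  (`n = 2r`); this is the `𝔅ⁿₘ = 𝔇ⁿₘ` direction of Aoki's Theorem A one prime short of its sharp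
  boundary `p > n + 1` (at the boundary prime `p = n + 3` the counting has no room; the sharp case needs
  the level-lowering relations of Aoki §9 and is not attempted here).

Proof. Write each entry as `αᵢ = (m/Mᵢ)·wᵢ` with `Mᵢ ∣ m` its exact level and `wᵢ` a unit mod `Mᵢ`;
let `c_M(w) = #{i : Mᵢ = M, wᵢ = w}`. By downward induction over the levels `M ∣ m` (`level_count_even`)
we show `c_M(-w) = c_M(w)`: Aoki's criterion at `f = M` (the Hodge condition summed against an odd
primitive `χ` mod `M`) involves the entries of level divisible by `M`; those of the levels `M' ⊋ M`
drop out because `c_{M'}` is already even and `χ` is odd (`sum_level_eq_zero_of_criterion`); what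
remains says that `c_M`, a configuration of at most `R` points, is annihilated by every odd primitive
character mod `M`, hence even by `even_of_oddNull` (`R + 2 < p` for `p ∣ M`). Evenness of all `c_M` is
the symmetry `#{i : αᵢ = x} = #{i : αᵢ = -x}`, and `isPaired_of_card_filter_eq` (`FermatHodgeCharacters`)
orients the pairs.

Everything here is proved; no named facts.

References: [Aoki1983] N. Aoki, Math. Ann. 266 (1983) 23–54, Thm. A, Prop. 2.2, Prop. 6.4;
[Ran1980] Z. Ran, Compositio Math. 42 (1980), Prop. 1.8 (i) (`m` prime: the tree's
`FermatCharacter.IsHodge.isPaired`).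
-/

set_option linter.dupNamespace false

noncomputable section

open Finset
open Literature.AlgebraicGeometry.HodgeTheory Literature.AlgebraicGeometry.HodgeTheory.FermatCharacter

namespace Summit.HodgeConjecture.HodgeConjecture.Theorems.CancelByAnyClaimLattice

namespace PairedNull

section Pairing

variable {R : ℕ} {m : ℕ} [NeZero m] {α : Fin R → ZMod m}

/-- **The level-`M` multiplicities of a Hodge character are even** (the core induction). Let `α`
be a Hodge character of level `m` with `R ≥ 2` entries and `R + 2 < p` for every prime `p ∣ m`.
Then for every `M ∣ m` and every `v` mod `M`, the number of entries of exact level `M` with unit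
part `-v` equals the number with unit part `v`. [cite: Aoki1983, Thm. A with Prop. 2.2 and Prop. 6.4] -/
theorem level_count_even (h : IsHodge α) (hR2 : 2 ≤ R) (hR : ∀ p ∈ m.primeFactors, R + 2 < p) :
    ∀ (d M : ℕ), M ∣ m → m / M = d → ∀ v : ZMod M,
      #(univ.filter fun i : Fin R ↦ m / m.gcd (α i).val = M ∧ ((((α i).val / (m / M)) : ℕ) : ZMod M) = -v) =
      #(univ.filter fun i : Fin R ↦ m / m.gcd (α i).val = M ∧ ((((α i).val / (m / M)) : ℕ) : ZMod M) = v) := by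
  classical
  intro d
  induction d using Nat.strong_induction_on with
  | _ d ih =>
  intro M hMm hdM v
  have hm0 : m ≠ 0 := NeZero.ne m
  have hM0 : M ≠ 0 := fun h0 ↦ hm0 (by rw [h0] at hMm; exact zero_dvd_iff.mp hMm)
  haveI : NeZero M := ⟨hM0⟩
  -- the induction hypothesis at the proper multiples `M'` of `M`
  have hIH : ∀ M' : ℕ, M' ∣ m → M ∣ M' → M' ≠ M → ∀ u : ZMod M',
      #(univ.filter fun i : Fin R ↦ m / m.gcd (α i).val = M' ∧ ((((α i).val / (m / M')) : ℕ) : ZMod M') = -u) =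
      #(univ.filter fun i : Fin R ↦ m / m.gcd (α i).val = M' ∧ ((((α i).val / (m / M')) : ℕ) : ZMod M') = u) := by
    intro M' hM'm hMM' hne u
    have hM'0 : M' ≠ 0 := fun h0 ↦ hm0 (by rw [h0] at hM'm; exact zero_dvd_iff.mp hM'm)
    obtain ⟨t, rfl⟩ := hMM'
    obtain ⟨s, hs⟩ := hM'm
    have ht1 : t ≠ 1 := fun h1 ↦ hne (by rw [h1, mul_one])
    have ht0 : t ≠ 0 := fun h0 ↦ hM'0 (by rw [h0, mul_zero])
    have hs0 : 0 < s := Nat.pos_of_ne_zero fun h0 ↦ hm0 (by rw [hs, h0, mul_zero])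
    have hlt : m / (M * t) < d := by
      have h1 : m / (M * t) = s := by
        rw [hs, Nat.mul_div_cancel_left _ (Nat.pos_of_ne_zero hM'0)]
      have h2 : d = t * s := by
        rw [← hdM, hs, mul_assoc, Nat.mul_div_cancel_left _ (Nat.pos_of_ne_zero hM0)]
      rw [h1, h2]
      calc s = 1 * s := (one_mul s).symm
        _ < t * s := Nat.mul_lt_mul_of_lt_of_le (by omega) (le_refl s) hs0
    exact ih _ hlt (M * t) ⟨s, hs⟩ rfl u
  -- the configuration `T` on `ℤ/M`: the multiplicities of the unit parts of the level-`M` entries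
  set T : ZMod M → ℂ := fun u ↦
    (#(univ.filter fun i : Fin R ↦ m / m.gcd (α i).val = M ∧ ((((α i).val / (m / M)) : ℕ) : ZMod M) = u) : ℂ)
    with hT
  -- level data of the entries
  have hspec : ∀ i, IsUnit ((((α i).val / (m / (m / m.gcd (α i).val)) : ℕ) : ZMod (m / m.gcd (α i).val))) ∧
      ((m / (m / m.gcd (α i).val) : ℕ) : ZMod m) *
        ((ZMod.val ((((α i).val / (m / (m / m.gcd (α i).val)) : ℕ) : ZMod (m / m.gcd (α i).val))) : ℕ) : ZMod m)
          = α i :=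
    fun i ↦ unitPart_spec (α i)
  -- the two cast lemmas (the level is substituted, so no dependent rewriting is needed later)
  have hcastM : ∀ (L : ℕ) (_ : L = M) (y : ZMod m),
      (ZMod.cast ((((y.val / (m / L)) : ℕ) : ZMod L)) : ZMod M) = (((y.val / (m / M)) : ℕ) : ZMod M) := by
    intro L hL y; subst hL; exact ZMod.cast_id _ _
  have hcast : ∀ (L M' : ℕ) (_ : L = M') (hMM' : M ∣ M') (y : ZMod m),
      (ZMod.cast ((((y.val / (m / L)) : ℕ) : ZMod L)) : ZMod M) =
        ZMod.castHom hMM' (ZMod M) ((((y.val / (m / M')) : ℕ) : ZMod M')) := by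
    intro L M' hL hMM' y; subst hL; rfl
  -- (i) `T` is supported on units
  have hTu : ∀ u, ¬ IsUnit u → T u = 0 := by
    intro u hu
    simp only [hT, Nat.cast_eq_zero, Finset.card_eq_zero, Finset.filter_eq_empty_iff]
    intro i _ hi
    apply hu
    have hdvd : M ∣ m / m.gcd (α i).val := by rw [hi.1]
    rw [← hi.2, ← hcastM _ hi.1 (α i)]
    exact ((hspec i).1).map (ZMod.castHom hdvd (ZMod M))
  -- (ii) `T` has at most `R` support points
  have hTcard : ∀ p ∈ M.primeFactors, #(univ.filter fun u : ZMod M ↦ T u ≠ 0) + 2 < p := by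
    intro p hp
    have hpm : p ∈ m.primeFactors :=
      Nat.mem_primeFactors.mpr ⟨Nat.prime_of_mem_primeFactors hp,
        dvd_trans (Nat.dvd_of_mem_primeFactors hp) hMm, hm0⟩
    refine lt_of_le_of_lt (Nat.add_le_add_right ?_ 2) (hR p hpm)
    calc #(univ.filter fun u : ZMod M ↦ T u ≠ 0)
        ≤ #(univ.image fun i : Fin R ↦ ((((α i).val / (m / M)) : ℕ) : ZMod M)) := by
          refine Finset.card_le_card fun u hu ↦ ?_
          rw [mem_filter] at hu
          have hne : #(univ.filter fun i : Fin R ↦ m / m.gcd (α i).val = M ∧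
              ((((α i).val / (m / M)) : ℕ) : ZMod M) = u) ≠ 0 := by
            intro h0; exact hu.2 (by simp only [hT, h0, Nat.cast_zero])
          obtain ⟨i, hi⟩ := Finset.card_ne_zero.mp hne
          rw [mem_filter] at hi
          exact mem_image.mpr ⟨i, mem_univ _, hi.2.2⟩
      _ ≤ #(univ : Finset (Fin R)) := Finset.card_image_le
      _ = R := by rw [Finset.card_univ, Fintype.card_fin]
  -- every prime factor of `M` is `≥ 5`
  have hM5 : ∀ p ∈ M.primeFactors, 5 ≤ p := by
    intro p hp
    have hpm : p ∈ m.primeFactors :=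
      Nat.mem_primeFactors.mpr ⟨Nat.prime_of_mem_primeFactors hp,
        dvd_trans (Nat.dvd_of_mem_primeFactors hp) hMm, hm0⟩
    have := hR p hpm
    omega
  -- (iii) `T` is annihilated by every odd primitive character mod `M`
  have hTodd : ∀ χ : DirichletCharacter ℂ M, χ.Odd → χ.IsPrimitive → ∑ u : ZMod M, T u * χ u = 0 := by
    intro χ hχ hprim
    -- Aoki's criterion at `f = M`
    haveI : ∀ i, NeZero (m / m.gcd (α i).val) := fun i ↦ ⟨(level_pos (α i)).ne'⟩
    have key := h.aoki_criterion hMm hχ hprim (fun i ↦ m / m.gcd (α i).val) (fun i ↦ level_dvd (α i))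
      (fun i ↦ ((((α i).val / (m / (m / m.gcd (α i).val)) : ℕ) : ZMod (m / m.gcd (α i).val))))
      (fun i ↦ (hspec i).1) (fun i ↦ (hspec i).2.symm)
    -- the Euler factor at level `M` itself is `1`
    have hone : (∏ p ∈ M.primeFactors, (1 - χ p)) = 1 := by
      refine Finset.prod_eq_one fun p hp ↦ ?_
      have hpM : p ∣ M := Nat.dvd_of_mem_primeFactors hp
      have hp1 : p.Prime := Nat.prime_of_mem_primeFactors hp
      have hnu : ¬ IsUnit ((p : ℕ) : ZMod M) := by
        rw [ZMod.isUnit_iff_coprime]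
        intro hc
        exact hp1.one_lt.ne' (Nat.Coprime.eq_one_of_dvd hc hpM)
      rw [χ.map_nonunit hnu, sub_zero]
    have hA : (fun L : ℕ ↦ ((m.totient : ℂ) / (L.totient : ℂ)) * ∏ p ∈ L.primeFactors, (1 - χ p)) M ≠ 0 := by
      show ((m.totient : ℂ) / (M.totient : ℂ)) * ∏ p ∈ M.primeFactors, (1 - χ p) ≠ 0
      rw [hone, mul_one]
      exact div_ne_zero (by exact_mod_cast (Nat.totient_pos.mpr (NeZero.pos m)).ne')
        (by exact_mod_cast (Nat.totient_pos.mpr (NeZero.pos M)).ne')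
    have key' := sum_level_eq_zero_of_criterion χ hχ (fun i ↦ m / m.gcd (α i).val)
      (fun i ↦ (level_pos (α i)).ne')
      (fun i ↦ ((((α i).val / (m / (m / m.gcd (α i).val)) : ℕ) : ZMod (m / m.gcd (α i).val))))
      (fun L : ℕ ↦ ((m.totient : ℂ) / (L.totient : ℂ)) * ∏ p ∈ L.primeFactors, (1 - χ p)) hA key
      (fun i ↦ ((((α i).val / (m / M)) : ℕ) : ZMod M)) (fun i hi ↦ hcastM _ hi (α i))
      (fun L i ↦ ((((α i).val / (m / L)) : ℕ) : ZMod L)) (fun L hML i hiL ↦ hcast _ L hiL hML (α i))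
      (fun L ⟨i, hiL⟩ hML hLM u ↦ hIH L (hiL ▸ level_dvd (α i)) hML hLM u)
    -- fibrewise: `∑_u T(u) (χ u)⁻¹ = 0`
    rw [sum_comp_eq_sum_card_mul (univ.filter fun i : Fin R ↦ m / m.gcd (α i).val = M)
      (fun i ↦ ((((α i).val / (m / M)) : ℕ) : ZMod M)) (fun u ↦ (χ u)⁻¹)] at key'
    simp only [Finset.filter_filter] at key'
    -- conjugate: `T` is real and `(χ u)⁻¹ = conj (χ u)`
    have hconj : starRingEnd ℂ (∑ u : ZMod M, T u * χ u) = 0 := by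
      rw [map_sum, ← key']
      refine Finset.sum_congr rfl fun u _ ↦ ?_
      rw [map_mul, hT, Complex.conj_natCast, char_inv_eq_conj]
    have := congrArg (starRingEnd ℂ) hconj
    rwa [starRingEnd_self_apply, map_zero] at this
  -- (iv) evenness
  have heven := even_of_oddNull hM5 T hTu hTodd hTcard v
  simp only [hT, Nat.cast_inj] at heven
  exact heven

/-! ### The theorem -/

/-- **Hodge characters are paired when every prime factor of the level exceeds the length plus
two.** For a Hodge character `α : Fin R → ℤ/m` (non-zero entries summing to `0` with
`2 ∑ᵢ ⟨t αᵢ⟩ = m R` for all units `t`) such that `R + 2 < p` for every prime `p ∣ m`, there is a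
fixed-point-free involution `σ` of `Fin R` with `α (σ i) = -α i`. For `R = n + 2` this is the
`𝔅ⁿₘ = 𝔇ⁿₘ` direction of Aoki's Theorem A under `p > n + 4` (sharp bound in print: `p > n + 1`).
[cite: Aoki1983, Thm. A] -/
theorem isPaired_of_primeFactors_gt : ∀ {R m : ℕ} [NeZero m] {α : Fin R → ZMod m}, IsHodge α → (∀ p ∈ m.primeFactors, R + 2 < p) → IsPaired α := by
  intro R m _ α h hR
  classical
  have hm0 : m ≠ 0 := NeZero.ne m
  -- degenerate lengths
  rcases Nat.lt_or_ge R 2 with hR2 | hR2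
  · match R, α, h with
    | 0, α, _ => exact ⟨Equiv.refl _, fun i ↦ i.elim0, fun i ↦ i.elim0, fun i ↦ i.elim0⟩
    | 1, α, h =>
      exfalso
      have hsum := h.1.2
      rw [Fin.sum_univ_one] at hsum
      exact h.1.1 0 hsum
    | R' + 2, _, _ => omega
  -- `m` is odd, so no entry equals its own negative
  have hmodd : ¬ 2 ∣ m := by
    intro h2
    have := hR 2 (Nat.mem_primeFactors.mpr ⟨Nat.prime_two, h2, hm0⟩)
    omega
  have hne : ∀ i, α i ≠ -α i := by
    intro i hi
    have h2 : (2 : ZMod m) * α i = 0 := by rw [two_mul]; nth_rewrite 2 [hi]; exact add_neg_cancel _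
    have h2u : IsUnit (2 : ZMod m) := by
      rw [show (2 : ZMod m) = ((2 : ℕ) : ZMod m) by norm_cast, ZMod.isUnit_iff_coprime]
      exact (Nat.coprime_two_left).mpr (Nat.odd_iff.mpr (Nat.two_dvd_ne_zero.mp hmodd))
    exact h.1.1 i ((h2u.mul_right_eq_zero).mp h2)
  refine isPaired_of_card_filter_eq hne fun x ↦ ?_
  by_cases hx : x = 0
  · rw [hx, neg_zero]
  -- count through the level decomposition of `x`
  set M := m / m.gcd x.val with hM
  have hMm : M ∣ m := level_dvd x
  have hfibre : ∀ y : ZMod m, m / m.gcd y.val = M →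
      (univ.filter fun i : Fin R ↦ α i = y) =
        univ.filter fun i : Fin R ↦ m / m.gcd (α i).val = M ∧
          ((((α i).val / (m / M)) : ℕ) : ZMod M) = (((y.val / (m / M)) : ℕ) : ZMod M) := by
    intro y hy
    ext i
    simp only [mem_filter, mem_univ, true_and]
    constructor
    · rintro rfl; exact ⟨hy, rfl⟩
    · rintro ⟨hli, hri⟩
      exact eq_of_level_eq_of_unitPart_eq hli hy hri
  rw [hfibre x rfl, hfibre (-x) (by rw [level_neg]), unitPart_neg hx hM.symm]
  exact (level_count_even h hR2 hR (m / M) M hMm rfl _).symm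

end Pairing

end PairedNull

end Summit.HodgeConjecture.HodgeConjecture.Theorems.CancelByAnyClaimLattice

end
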